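import Literature.Probability.LatticeModels.GlauberDynamicsLogSobolevBounds
import HarnessLib

/-!
# Log-Sobolev inequalities seen through a frozen block ([Mar99] Theorem 4.6, (4.21)), PROVED

Topic `Literature/Probability/LatticeModels`; cell `ym-ir`, seat lit-3 (census rows B2/B4).  Theorems only
(D-0026).  In [Mar99] Theorem 4.6, (4.21) p0190 L29 – p0191 L4, the log-Sobolev inequality of `μ_{R^top}^τ` is
transferred to `μ_R^τ` for the function `g_n = (μ_{R^bot}(f²))^{1/2}`, which does not read the spins of the
block `B = R^bot`, through Proposition 3.11 (PROVED: `Glauber.Martinelli1999_prop3_11`, which compares two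
measures dominating each other SETWISE).  The reduction to setwise domination is by pushing both measures
forward under the map `φ_B^τ : σ ↦ (τ on B, σ off B)` («freezing the block»): (i) the log-Sobolev inequality
passes to the push-forward with the same constant (`Glauber.LogSobolevIneq.map_freeze`, since
`|∇_V (f ∘ φ)|² ≤ |∇_V f|² ∘ φ`), (ii) for observables not reading `B` all the integrals agree
(`integral_map` — recorded as `Glauber.integral_map_freeze_of_dependsOn`), and (iii) setwise domination of the
push-forwards is domination on `𝓕_{B^c}`-events (`Glauber.map_freeze_le_smul`), which is what the two-block
density bounds of `GibbsRelativeDensitySMT` provide.  SIBLING-SETTING material; the Yang–Mills gap is not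
touched. [cite: Martinelli1999, Theorem 4.6, proof, (4.21)]
-/

open MeasureTheory ProbabilityTheory Finset Filter

noncomputable section

namespace Literature.Probability.LatticeModels

namespace Glauber

variable {d : ℕ}

/-- The block-freezing map is measurable. [cite: Martinelli1999, Theorem 4.6, proof, (4.21)] -/
theorem measurable_freeze (B : Finset (Site d)) (τ : Site d → ℤˣ) :
    Measurable fun σ : Site d → ℤˣ => B.piecewise τ σ := by
  classical
  refine measurable_pi_iff.2 fun x => ?_
  by_cases hx : x ∈ B
  · simp only [Finset.piecewise_eq_of_mem _ _ _ hx]; exact measurable_const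
  · simp only [Finset.piecewise_eq_of_notMem _ _ _ hx]; exact measurable_pi_apply x

/-- Freezing commutes with a flip off the block and absorbs a flip in the block.
[cite: Martinelli1999, Theorem 4.6, proof, (4.21)] -/
theorem freeze_spinFlip (B : Finset (Site d)) (τ σ : Site d → ℤˣ) (x : Site d) :
    B.piecewise τ (spinFlip x σ) = if x ∈ B then B.piecewise τ σ else spinFlip x (B.piecewise τ σ) := by
  classical
  split_ifs with hx
  · funext y
    by_cases hy : y ∈ B
    · rw [Finset.piecewise_eq_of_mem _ _ _ hy, Finset.piecewise_eq_of_mem _ _ _ hy]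
    · rw [Finset.piecewise_eq_of_notMem _ _ _ hy, Finset.piecewise_eq_of_notMem _ _ _ hy, spinFlip_apply]
      have hyx : y ≠ x := fun h => hy (h ▸ hx)
      rw [if_neg hyx]
  · funext y
    rw [spinFlip_apply]
    by_cases hy : y ∈ B
    · have hyx : y ≠ x := fun h => hx (h ▸ hy)
      rw [Finset.piecewise_eq_of_mem _ _ _ hy, if_neg hyx, Finset.piecewise_eq_of_mem _ _ _ hy]
    · rw [Finset.piecewise_eq_of_notMem _ _ _ hy, spinFlip_apply]
      by_cases hyx : y = x
      · subst hyx; rw [if_pos rfl, if_pos rfl, Finset.piecewise_eq_of_notMem _ _ _ hy]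
      · rw [if_neg hyx, if_neg hyx, Finset.piecewise_eq_of_notMem _ _ _ hy]

/-- `|∇_V (f ∘ φ)|² ≤ |∇_V f|² ∘ φ` for the freezing map `φ`. [cite: Martinelli1999, Theorem 4.6, proof, (4.21)] -/
theorem gradSq_comp_freeze_le (B V : Finset (Site d)) (τ : Site d → ℤˣ) (f : (Site d → ℤˣ) → ℝ)
    (σ : Site d → ℤˣ) :
    gradSq V (fun ω => f (B.piecewise τ ω)) σ ≤ gradSq V f (B.piecewise τ σ) := by
  classical
  unfold gradSq siteGrad
  refine Finset.sum_le_sum fun x _ => ?_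
  show (f (B.piecewise τ (spinFlip x σ)) - f (B.piecewise τ σ)) ^ 2 ≤ _
  rw [freeze_spinFlip]
  split_ifs with hx
  · rw [sub_self, zero_pow two_ne_zero]; positivity
  · exact le_rfl

/-- **The log-Sobolev inequality passes to the frozen-block push-forward** with the same constant.
[cite: Martinelli1999, Theorem 4.6, proof, (4.21)] -/
theorem LogSobolevIneq.map_freeze {ν : Measure (Site d → ℤˣ)} [IsProbabilityMeasure ν] {V : Finset (Site d)}
    {c : ℝ} (hc : 0 ≤ c) (h : LogSobolevIneq ν V c) (B : Finset (Site d)) (τ : Site d → ℤˣ) :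
    LogSobolevIneq (ν.map fun σ => B.piecewise τ σ) V c := by
  classical
  have hφ := measurable_freeze B τ
  haveI : IsProbabilityMeasure (ν.map fun σ => B.piecewise τ σ) :=
    ⟨by rw [Measure.map_apply hφ MeasurableSet.univ, Set.preimage_univ, measure_univ]⟩
  intro f hf hbdd hpos
  obtain ⟨C, hC⟩ := hbdd
  have hfφ : Measurable fun ω => f (B.piecewise τ ω) := hf.comp hφ
  have key := h (fun ω => f (B.piecewise τ ω)) hfφ ⟨C, fun σ => hC _⟩ (fun σ => hpos _)
  rw [integral_map hφ.aemeasurable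
      (show AEStronglyMeasurable (fun σ => f σ ^ 2 * Real.log (f σ)) _ from
        ((hf.pow_const 2).mul hf.log).aestronglyMeasurable),
    integral_map hφ.aemeasurable
      (show AEStronglyMeasurable (fun σ => f σ ^ 2) _ from (hf.pow_const 2).aestronglyMeasurable)]
  unfold dirichletForm at key ⊢
  rw [integral_map hφ.aemeasurable (measurable_gradSq V hf).aestronglyMeasurable]
  have hint : ∫ σ, gradSq V (fun ω => f (B.piecewise τ ω)) σ ∂ν ≤ ∫ σ, gradSq V f (B.piecewise τ σ) ∂ν := by
    refine integral_mono_of_nonneg (Eventually.of_forall fun σ => gradSq_nonneg _ _ _) ?_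
      (Eventually.of_forall fun σ => gradSq_comp_freeze_le B V τ f σ)
    exact Integrable.of_bound ((measurable_gradSq V hf).comp hφ).aestronglyMeasurable (4 * V.card * C ^ 2)
      (Eventually.of_forall fun σ => by
        rw [Real.norm_eq_abs]
        show |gradSq V f (B.piecewise τ σ)| ≤ _
        rw [abs_of_nonneg (gradSq_nonneg _ _ _)]; exact gradSq_le V hC _)
  have h2 := mul_le_mul_of_nonneg_left hint (show (0 : ℝ) ≤ c * (1 / 2) by positivity)
  linarith [key, h2]

/-- For observables not reading the block, the push-forward integrates like the measure itself.
[cite: Martinelli1999, Theorem 4.6, proof, (4.21)] -/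
theorem integral_map_freeze_of_dependsOn {ν : Measure (Site d → ℤˣ)} (B : Finset (Site d)) (τ : Site d → ℤˣ)
    {g : (Site d → ℤˣ) → ℝ} (hg : Measurable g) (hdep : DependsOn g ((↑B : Set (Site d))ᶜ)) :
    ∫ σ, g σ ∂(ν.map fun σ => B.piecewise τ σ) = ∫ σ, g σ ∂ν := by
  classical
  rw [integral_map (measurable_freeze B τ).aemeasurable hg.aestronglyMeasurable]
  refine integral_congr_ae (Eventually.of_forall fun σ => hdep fun x hx => ?_)
  have hxB : x ∉ B := fun h => hx (Finset.mem_coe.2 h)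
  exact Finset.piecewise_eq_of_notMem _ _ _ hxB

/-- **Setwise domination of the push-forwards from domination on `𝓕_{B^c}`-events.**
[cite: Martinelli1999, Theorem 4.6, proof, (4.21)] -/
theorem map_freeze_le_smul {ν₁ ν₂ : Measure (Site d → ℤˣ)} (B : Finset (Site d)) (τ : Site d → ℤˣ)
    {ε : NNReal}
    (h : ∀ E : Set (Site d → ℤˣ), MeasurableSet E → DependsOn (· ∈ E) ((↑B : Set (Site d))ᶜ) →
      ν₁ E ≤ ε * ν₂ E) :
    (ν₁.map fun σ => B.piecewise τ σ) ≤ ε • (ν₂.map fun σ => B.piecewise τ σ) := by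
  classical
  have hφ := measurable_freeze B τ
  refine Measure.le_iff.2 fun S hS => ?_
  rw [Measure.map_apply hφ hS, Measure.smul_apply, Measure.map_apply hφ hS, ENNReal.smul_def, smul_eq_mul]
  refine h _ (hφ hS) fun σ σ' hσσ' => ?_
  have : B.piecewise τ σ = B.piecewise τ σ' := by
    funext x
    by_cases hx : x ∈ B
    · rw [Finset.piecewise_eq_of_mem _ _ _ hx, Finset.piecewise_eq_of_mem _ _ _ hx]
    · rw [Finset.piecewise_eq_of_notMem _ _ _ hx, Finset.piecewise_eq_of_notMem _ _ _ hx]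
      exact hσσ' x (fun h => hx (Finset.mem_coe.1 h))
  simp only [Set.mem_preimage, this]

end Glauber

end Literature.Probability.LatticeModels

end
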